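import Summits.AnomalousDissipation.AnomalousDissipation.Theorems.SolenoidalFractalHomogenisationLagrangianStepFrameContinuity
import Literature.Analysis.FluidPDE.PassiveVectorTensorDistortedFrameTest

/-!
# K1L_D (stmt-AnomalousDissipation-27980), `stub_Z7_alphaBeta` (α) / memo L15: `frameG` has SMOOTH entries at ALL times (incl. window endpoints)
# (helper, `--supports 27980 --as helper`; prover ad-k1loc-p3 g8 — complement to lead-k1l-onelevel-p1 g5's (C0) files `…FrameGroupLaw`/`…FrameContinuity`)

`…FrameContinuity` (lead g5) gives CONTINUITY of `frameG = frameJac⁻¹` at all times; the window package (`FrameForm.isSmooth_frameG_entry`,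
p695470) gives SMOOTHNESS only for `t′ − jR ≤ T < refresh (m+1)` (through `frameG = adj frameJac`, Liouville).  Here: smoothness at ALL
times `t′, s` from `LevelRegular` alone — `frameG = (det frameJac)⁻¹ • adj frameJac` (`Matrix.inv_def`) with `det frameJac ≠ 0`
(`FrameConj.isUnit_frameJac`, p699864) and `det`, `adj` polynomial in the smooth entries (`FrameConj.isSmooth_frameJac_entry`):
`det_frameJac_ne_zero`, `isSmooth_det_frameJac`, `isSmooth_adjugate_frameJac_entry'`, **`isSmooth_frameG_entry'`**, and the smoothness of
distorted smooth fields `isSmooth_distort_frameG` (the `hΨs`-type input for frame tests `distort (frameG …) Ψ` at every time, e.g. at the CLOSED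
right endpoint of a refresh window where the strict-window lemmas do not apply).  NOT (T1), not the stub, not K1L_D, not AD; rung F-D1.A0.
-/

set_option linter.dupNamespace false

noncomputable section

namespace Summit.AnomalousDissipation.AnomalousDissipation.Theorems.SolenoidalFractalHomogenisation.LagrangianStep.FrameForm

open Set Function
open Literature.Analysis Literature.Analysis.FunctionSpaces Literature.Analysis.FunctionSpaces.Torus
open Literature.Analysis.FluidPDE Literature.Analysis.FluidPDE.LatticeShear

variable {k : ℕ}

/-- `det frameJac ≠ 0` at all times. [folklore] -/
theorem det_frameJac_ne_zero (E : LagrangianLatticeCarrier k) (hR : E.LevelRegular) (m : ℕ) (t' s : ℝ) (y : UnitAddTorus (Fin 3)) :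
    (frameJac E m t' s y).det ≠ 0 := by
  have h := FrameConj.isUnit_frameJac E hR m t' s y
  rw [Matrix.isUnit_iff_isUnit_det, isUnit_iff_ne_zero] at h
  exact h

/-- `y ↦ det (frameJac E m t′ s y)` is smooth at all times (a cubic polynomial in the smooth entries). [folklore] -/
theorem isSmooth_det_frameJac (E : LagrangianLatticeCarrier k) (hR : E.LevelRegular) (m : ℕ) (t' s : ℝ) :
    IsSmooth (fun y => (frameJac E m t' s y).det) := by
  have h : ∀ a c : Fin 3, ContDiff ℝ (⊤ : ℕ∞) (fun z : EuclideanSpace ℝ (Fin 3) => frameJac E m t' s (proj z) a c) :=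
    fun a c => FrameConj.isSmooth_frameJac_entry E hR m t' s a c
  unfold IsSmooth lift
  simp only [Function.comp_def, Matrix.det_fin_three]
  fun_prop

/-- Every entry of `adj (frameJac E m t′ s y)` is smooth in `y` at all times. [folklore] -/
theorem isSmooth_adjugate_frameJac_entry' (E : LagrangianLatticeCarrier k) (hR : E.LevelRegular) (m : ℕ) (t' s : ℝ) (i l : Fin 3) :
    IsSmooth (fun y => (frameJac E m t' s y).adjugate i l) := by
  have h : ∀ a c : Fin 3, ContDiff ℝ (⊤ : ℕ∞) (fun z : EuclideanSpace ℝ (Fin 3) => frameJac E m t' s (proj z) a c) :=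
    fun a c => FrameConj.isSmooth_frameJac_entry E hR m t' s a c
  unfold IsSmooth lift
  simp only [Function.comp_def, Matrix.adjugate_fin_three]
  fin_cases i <;> fin_cases l <;>
    simp only [Fin.zero_eta, Fin.mk_one, Fin.reduceFinMk, Matrix.of_apply, Matrix.cons_val', Matrix.cons_val_zero,
      Matrix.cons_val_one, Matrix.cons_val_two, Matrix.cons_val_fin_one, Matrix.empty_val', Matrix.head_cons, Matrix.tail_cons,
      Matrix.head_fin_const] <;>
    fun_prop

/-- **Every entry of `frameG = (frameJac)⁻¹` is smooth in the label at ALL times** (`(det)⁻¹ • adjugate`, `det ≠ 0`). [folklore] -/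
theorem isSmooth_frameG_entry' (E : LagrangianLatticeCarrier k) (hR : E.LevelRegular) (m : ℕ) (t' s : ℝ) (i l : Fin 3) :
    IsSmooth (fun y => frameG E m t' s y i l) := by
  have e : (fun y => frameG E m t' s y i l) = fun y => ((frameJac E m t' s y).det)⁻¹ * (frameJac E m t' s y).adjugate i l := by
    funext y
    rw [frameG, Matrix.inv_def, Ring.inverse_eq_inv, Matrix.smul_apply, smul_eq_mul]
  rw [e]
  have hdet : ContDiff ℝ (⊤ : ℕ∞) (fun z : EuclideanSpace ℝ (Fin 3) => ((frameJac E m t' s (proj z)).det)⁻¹) :=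
    ContDiff.inv (isSmooth_det_frameJac E hR m t' s) fun z => det_frameJac_ne_zero E hR m t' s (proj z)
  exact hdet.mul (isSmooth_adjugate_frameJac_entry' E hR m t' s i l)

/-- **Distortion by `frameG` preserves smoothness at ALL times**: `distort (frameG E m t′ s) Ψ` is smooth for smooth `Ψ`. [folklore] -/
theorem isSmooth_distort_frameG (E : LagrangianLatticeCarrier k) (hR : E.LevelRegular) (m : ℕ) (t' s : ℝ)
    {Ψ : UnitAddTorus (Fin 3) → EuclideanSpace ℝ (Fin 3)} (hΨ : IsSmooth Ψ) :
    IsSmooth (FluidPDE.Torus.distort (frameG E m t' s) Ψ) :=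
  FluidPDE.Torus.isSmooth_distort (fun a c => isSmooth_frameG_entry' E hR m t' s a c) hΨ

end Summit.AnomalousDissipation.AnomalousDissipation.Theorems.SolenoidalFractalHomogenisation.LagrangianStep.FrameForm

end
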